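import Summits.CriticalPhenomena.PercolationContinuityZ3.Theorems.PercNearOneGluingNoHeavyConstsClusterSquareMinorBridge
import HarnessLib

/-!
# The converse: a `W₄` minor is a cross-linkage at its hub set (exactness of the `W₄`-minor-free class for the two-copy method)

builds on p205010 (kernel theorem, internal audit signed; external expert review pending)

PAPER-2 track "percolation constants", part (ii), seat `prim-consts-1`, gen 23 (lane index
`run/shared/lean/prim/consts/CONSTANTS.md`, row A19; memo `FROM-prim-consts-1-g23-SERIES-PARALLEL.md` §0(1)).
Support file for the crux `NoHeavyLowerTail` (stmt-CriticalPhenomena-4575; `--supports`).  Theorems only (pure graph theory);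
no definitions, no sorries.

`…ConstsClusterSquareW4Minor.lean` shows: a cross-linkage at a connected vertex set `K` (four distinct outside vertices `y, z, y', z'`
with neighbours in `K`, vertex-disjoint `K`-avoiding walks `y→z ∥ y'→z'` and `y'→z ∥ y→z'`) is a `W₄` minor with hub set `K`.
THIS FILE records the (easy) converse, **`Consts.crossLinkage_of_W4Minor`**: a `W₄` model — hub `B₀`, rim `A₁, A₂, A₃, A₄` pairwise
disjoint, each inducing a connected subgraph, hub joined to every rim set, rim joined cyclically — yields a cross-linkage at `K = B₀`
(clash vertices: one `B₀`-neighbour in each rim set; the walks run inside `A₁ ∪ A₂ ∥ A₃ ∪ A₄` and `A₂ ∪ A₃ ∥ A₄ ∪ A₁`), i.e. the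
NEGATION of the hypothesis `hK` of `Consts.not_quadClash_of_unlinked₄` at some root `a ∈ B₀`.  Hence "no connected set carries a
cross-linkage" and "no `W₄` minor" are the same graph property, and "no connected `K ∋ a` carries one" is "`a` lies in no hub set of
a `W₄` model": the two-copy cluster-square criterion of gens 18/22 applies at every root EXACTLY on the `W₄`-minor-free graphs.
Also: `Consts.Minor.exists_walk_of_induce_connected` (walks inside an induced-connected set) and `Consts.Minor.closure_of_induce_connected`
(induced-connected ⟹ the closure form of connectivity used throughout the lane).
Census (lane g23): on all 12 113 connected graphs with ≤ 8 vertices "cross-linkage somewhere" ⟺ "W₄ minor" (exact enumeration).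
References: R. Diestel, Graph Theory (5th ed.), §1.7; N. Gladkov, arXiv:2408.08457v2 (2024), Thm. 4.3.
-/

namespace Summit.CriticalPhenomena.PercolationContinuityZ3.Theorems

namespace Consts

namespace Minor

variable {V : Type*} {H : SimpleGraph V}

/-- A set inducing a connected subgraph contains an `H`-walk between any two of its vertices. [folklore] -/
theorem exists_walk_of_induce_connected {S : Set V} (h : (H.induce S).Connected) {u v : V} (hu : u ∈ S) (hv : v ∈ S) :
    ∃ W : H.Walk u v, ∀ x ∈ W.support, x ∈ S := by
  obtain ⟨p⟩ := h.preconnected ⟨u, hu⟩ ⟨v, hv⟩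
  suffices key : ∀ (s t : S) (q : (H.induce S).Walk s t), ∃ W : H.Walk s.1 t.1, ∀ x ∈ W.support, x ∈ S from key _ _ p
  intro s t q
  induction q with
  | nil =>
    rename_i s
    refine ⟨SimpleGraph.Walk.nil, fun x hx => ?_⟩
    rw [SimpleGraph.Walk.support_nil, List.mem_singleton] at hx
    exact hx ▸ s.2
  | cons hst q' ih =>
    rename_i s t r
    obtain ⟨W, hW⟩ := ih
    refine ⟨SimpleGraph.Walk.cons ((SimpleGraph.Embedding.induce S).map_adj_iff.mpr hst) W, fun x hx => ?_⟩
    rw [SimpleGraph.Walk.support_cons, List.mem_cons] at hx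
    rcases hx with rfl | hx
    · exact s.2
    · exact hW x hx

/-- Induced-connected ⟹ connected from any of its vertices in CLOSURE form (every set containing `a` and closed under `H`-steps into
`K` contains `K`). [folklore] -/
theorem closure_of_induce_connected {K : Set V} (h : (H.induce K).Connected) {a : V} (ha : a ∈ K) :
    ∀ T : Set V, a ∈ T → (∀ u x, u ∈ T → H.Adj u x → x ∈ K → x ∈ T) → K ⊆ T := by
  intro T haT hT s hs
  obtain ⟨W, hW⟩ := exists_walk_of_induce_connected h ha hs
  -- walk induction: every vertex of a `K`-walk from a vertex of `T` lies in `T`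
  suffices key : ∀ (u v : V) (W : H.Walk u v), u ∈ T → (∀ x ∈ W.support, x ∈ K) → v ∈ T from key a s W haT hW
  intro u v W
  induction W with
  | nil => exact fun hu _ => hu
  | @cons u x v hux W' ih =>
    intro hu hK
    have hx : x ∈ K := hK x (List.mem_cons_of_mem _ W'.start_mem_support)
    exact ih (hT u x hu hux hx) fun t ht => hK t (List.mem_cons_of_mem _ ht)

/-- A walk inside the union of two sets avoids every set disjoint from both. [folklore] -/
theorem walk_avoids {S₁ S₂ K : Set V} (h1 : Disjoint K S₁) (h2 : Disjoint K S₂) {u v : V} (W : H.Walk u v)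
    (hW : ∀ x ∈ W.support, x ∈ S₁ ∪ S₂) : ∀ x ∈ W.support, x ∉ K := by
  intro x hx hxK
  rcases hW x hx with h | h
  · exact Set.disjoint_left.mp h1 hxK h
  · exact Set.disjoint_left.mp h2 hxK h

end Minor

open Minor in
/-- **A `W₄` model is a cross-linkage at its hub set.**  Given hub `B₀` and rim sets `A₁, A₂, A₃, A₄` (pairwise disjoint, each
inducing a connected subgraph, `B₀` joined to each `Aᵢ`, `A₁–A₂–A₃–A₄–A₁` joined cyclically), there are `a ∈ B₀` and distinct
`y, y', z, z' ∉ B₀` with neighbours in `B₀` and vertex-disjoint `B₀`-avoiding walks `y→z ∥ y'→z'` and `y'→z ∥ y→z'`, `B₀` being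
connected from `a` in closure form — the negation of hypothesis `hK` of `Consts.not_quadClash_of_unlinked₄` at `(a, K = B₀)`.
[cite: Diestel2017, §1.7 (minors as branch sets)] -/
theorem crossLinkage_of_W4Minor {V : Type*} (H : SimpleGraph V) {B₀ A₁ A₂ A₃ A₄ : Set V}
    (c0 : (H.induce B₀).Connected) (c1 : (H.induce A₁).Connected) (c2 : (H.induce A₂).Connected)
    (c3 : (H.induce A₃).Connected) (c4 : (H.induce A₄).Connected)
    (d01 : Disjoint B₀ A₁) (d02 : Disjoint B₀ A₂) (d03 : Disjoint B₀ A₃) (d04 : Disjoint B₀ A₄)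
    (d12 : Disjoint A₁ A₂) (d13 : Disjoint A₁ A₃) (d14 : Disjoint A₁ A₄) (d23 : Disjoint A₂ A₃) (d24 : Disjoint A₂ A₄)
    (d34 : Disjoint A₃ A₄)
    (a01 : ∃ u ∈ B₀, ∃ v ∈ A₁, H.Adj u v) (a02 : ∃ u ∈ B₀, ∃ v ∈ A₂, H.Adj u v) (a03 : ∃ u ∈ B₀, ∃ v ∈ A₃, H.Adj u v)
    (a04 : ∃ u ∈ B₀, ∃ v ∈ A₄, H.Adj u v)
    (a12 : ∃ u ∈ A₁, ∃ v ∈ A₂, H.Adj u v) (a23 : ∃ u ∈ A₂, ∃ v ∈ A₃, H.Adj u v) (a34 : ∃ u ∈ A₃, ∃ v ∈ A₄, H.Adj u v)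
    (a41 : ∃ u ∈ A₄, ∃ v ∈ A₁, H.Adj u v) :
    ∃ (a y y' z z' : V), a ∈ B₀ ∧
      (∀ T : Set V, a ∈ T → (∀ u x, u ∈ T → H.Adj u x → x ∈ B₀ → x ∈ T) → B₀ ⊆ T) ∧
      y ∉ B₀ ∧ y' ∉ B₀ ∧ z ∉ B₀ ∧ z' ∉ B₀ ∧
      (∃ k, k ∈ B₀ ∧ H.Adj k y) ∧ (∃ k, k ∈ B₀ ∧ H.Adj k y') ∧ (∃ k, k ∈ B₀ ∧ H.Adj k z) ∧ (∃ k, k ∈ B₀ ∧ H.Adj k z') ∧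
      y ≠ y' ∧ y ≠ z ∧ y ≠ z' ∧ y' ≠ z ∧ y' ≠ z' ∧ z ≠ z' ∧
      (∃ (R₁ : H.Walk y z) (R₂ : H.Walk y' z'), (∀ x ∈ R₁.support, x ∉ B₀) ∧ (∀ x ∈ R₂.support, x ∉ B₀) ∧
          ∀ x, x ∈ R₁.support → x ∉ R₂.support) ∧
      (∃ (R₃ : H.Walk y' z) (R₄ : H.Walk y z'), (∀ x ∈ R₃.support, x ∉ B₀) ∧ (∀ x ∈ R₄.support, x ∉ B₀) ∧
          ∀ x, x ∈ R₃.support → x ∉ R₄.support) := by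
  obtain ⟨k₁, hk₁, y, hy, hk₁y⟩ := a01
  obtain ⟨k₂, hk₂, z, hz, hk₂z⟩ := a02
  obtain ⟨k₃, hk₃, y', hy', hk₃y'⟩ := a03
  obtain ⟨k₄, hk₄, z', hz', hk₄z'⟩ := a04
  -- the four rim unions are connected
  obtain ⟨u₁, hu₁, v₂, hv₂, e12⟩ := a12
  obtain ⟨u₂, hu₂, v₃, hv₃, e23⟩ := a23
  obtain ⟨u₃, hu₃, v₄, hv₄, e34⟩ := a34
  obtain ⟨u₄, hu₄, v₁, hv₁, e41⟩ := a41
  have c12 : (H.induce (A₁ ∪ A₂)).Connected := SimpleGraph.connected_induce_union c1.preconnected c2.preconnected hu₁ hv₂ e12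
  have c23 : (H.induce (A₂ ∪ A₃)).Connected := SimpleGraph.connected_induce_union c2.preconnected c3.preconnected hu₂ hv₃ e23
  have c34 : (H.induce (A₃ ∪ A₄)).Connected := SimpleGraph.connected_induce_union c3.preconnected c4.preconnected hu₃ hv₄ e34
  have c41 : (H.induce (A₄ ∪ A₁)).Connected := SimpleGraph.connected_induce_union c4.preconnected c1.preconnected hu₄ hv₁ e41
  obtain ⟨R₁, hR₁⟩ := exists_walk_of_induce_connected c12 (Or.inl hy) (Or.inr hz)
  obtain ⟨R₂, hR₂⟩ := exists_walk_of_induce_connected c34 (Or.inl hy') (Or.inr hz')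
  obtain ⟨R₃, hR₃⟩ := exists_walk_of_induce_connected c23 (Or.inr hy') (Or.inl hz)
  obtain ⟨R₄, hR₄⟩ := exists_walk_of_induce_connected c41 (Or.inr hy) (Or.inl hz')
  have dis := fun {S T : Set V} (h : Disjoint S T) {x : V} (hs : x ∈ S) (ht : x ∈ T) => Set.disjoint_left.mp h hs ht
  refine ⟨k₁, y, y', z, z', hk₁, closure_of_induce_connected c0 hk₁, fun h => dis d01 h hy, fun h => dis d03 h hy',
    fun h => dis d02 h hz, fun h => dis d04 h hz', ⟨k₁, hk₁, hk₁y⟩, ⟨k₃, hk₃, hk₃y'⟩, ⟨k₂, hk₂, hk₂z⟩, ⟨k₄, hk₄, hk₄z'⟩,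
    fun h => dis d13 hy (h ▸ hy'), fun h => dis d12 hy (h ▸ hz), fun h => dis d14 hy (h ▸ hz'), fun h => dis d23 (h ▸ hz) hy',
    fun h => dis d34 hy' (h ▸ hz'), fun h => dis d24 hz (h ▸ hz'),
    ⟨R₁, R₂, walk_avoids d01 d02 R₁ hR₁, walk_avoids d03 d04 R₂ hR₂, fun x hx1 hx2 => ?_⟩,
    ⟨R₃, R₄, walk_avoids d02 d03 R₃ hR₃, walk_avoids d04 d01 R₄ hR₄, fun x hx3 hx4 => ?_⟩⟩
  · rcases hR₁ x hx1 with h1 | h1 <;> rcases hR₂ x hx2 with h2 | h2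
    · exact dis d13 h1 h2
    · exact dis d14 h1 h2
    · exact dis d23 h1 h2
    · exact dis d24 h1 h2
  · rcases hR₃ x hx3 with h3 | h3 <;> rcases hR₄ x hx4 with h4 | h4
    · exact dis d24 h3 h4
    · exact dis d12 h4 h3
    · exact dis d34 h3 h4
    · exact dis d13 h4 h3

end Consts

end Summit.CriticalPhenomena.PercolationContinuityZ3.Theorems
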